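import Mathlib
import Literature.MathematicalPhysics.QuantumFieldTheory.Balaban1983to89.B6FromB4

/-!
# `Balaban1983to89.B6Elimination` — the block elimination `ω = Cω′` of the constraint `Q′₁ω = 0` at the use site
(S2), p. 242 of B6, EXHIBITED with kernel-checked range / ℓ¹ / norm constants, and the p. 242 sentence *"a covariance
C′^{(j)}_Λ … is a bounded operator with an exponential decay independent of j and Λ"* as an instance of
`B6FromB4.reductions_uniform` (cell census: residual (b) of GAPS G-B6-05a = G-B6-07 = G-pv09g2-1 (iii), now closed in
the kernel modulo the named analytic leaves)

B6 = T. Bałaban, *Propagators and renormalization transformations for lattice gauge theories. II*, Commun. Math.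
Phys. **96**, 223–250 (1984) [Balaban1984PropagatorsII] (held `paper:balaban1984-cmp96-propagators-rt-ii`; journal
page = PDF page + 222).  B5 = T. Bałaban, *Propagators and renormalization transformations for lattice gauge
theories. I*, Commun. Math. Phys. **95**, 17–40 (1984) [Balaban1984PropagatorsI] (held
`paper:balaban1984-cmp95-propagators-rt-i`; journal page = PDF page + 16).  [3] = T. Bałaban, *Regularity and decay
of lattice Green's functions*, Commun. Math. Phys. **89**, 571–597 (1983) [Balaban1983RegularityDecay] = B4.
Every quotation below was read from the x2 page renders `b2b-balaban-ref1/pages/1984-cmp96-propagators-rt-II/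
…-p017,-p018,-p019,-p020,-p027,-p028-x2.png` (B6 pp. 239–242, 249, 250) and `…/1984-cmp95-propagators-rt-I/…-p002,-p003-x2.png`
(B5 pp. 18, 19), not from an OCR layer.  Neither `…B4`, `…B6` nor `…B6FromB4` is modified; this module imports
`…B6FromB4` (unit pv09-g2, p177133) and supplies the one datum its `Reduction.Printed` leaves abstract at (S2): the
matrix C.

CITATION HEADER (lean-in-tree rule 2026-08-18).  WHAT IS PRINTED (verbatim).
* B5 (1.6) p. 18: *"We define a new lattice T_L^{(1)} = T₁ ∩ LZ^d and we divide T₁ into blocks B(y) parametrized by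
  the points of T_L^{(1)}: B(y) = {x ∈ T₁ : y_μ ≤ x_μ < y_μ + L, μ = 1, …, d}, y ∈ T_L^{(1)}. (1.6)"*.
* B5 (1.13) p. 19: *"B^λ_c = B_c − L^{−1}(Σ_{x∈B(c₊)} L^{−d}λ(x) − Σ_{x∈B(c₋)} L^{−d}λ(x)) = B_c − L^{−1}((Q′λ)(c₊) −
  (Q′λ)(c₋)) = B_c − (∂Q′λ)(c). (1.13) Fixing it we restrict the gauge transformations by the condition
  (Q′λ)(y) = 0."* — i.e. (Q′λ)(y) = Σ_{x∈B(y)} L^{−d}λ(x); in B6 the one-step operator carries the subscript 1: Q′₁.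
* B6 p. 241 [PDF 19], (2.104): *"μ = 0 on Λᶜ, Q′₁μ = 0 on Λ′. (2.104) This matches our needs exactly because the
  unit lattice gauge functions ω appearing in the integral (2.97) satisfy the above conditions."*
* B6 p. 242 [PDF 20], (2.106)–(2.107): the last Gaussian integrals of (2.106) are
  *"∫dω↾_Λδ(Q′₁ω) e^{−½⟨ω,Δ′_jω⟩} e^{⟨ω, H′_j*Δ∂*A − H′_j*∂*J⟩} · (∫dω′↾_Λδ(Q′₁ω′) e^{−½⟨ω′,Δ′_jω′⟩} e^{⟨ω′,H′_j*Δ∂*A⟩})^{−1},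
  (2.106) where the second equality was obtained by the translation λ′ → λ′ + H′_jω, and the same translation in λ,
  and the operator Δ′_j was defined by the second equality, Δ′_j = H′_j*Δ²H′_j. (2.107)"*; then *"From this [(2.108)]
  we get an exponential decay of Δ′_j(y − y′) and the bound c₀‖Δ₀ω‖² ≤ ⟨ω, Δ′_jω⟩ ≤ c₁‖Δ₀ω‖² ≤ γ₁‖ω‖². (2.109) For ω
  satisfying Q′₁ω = 0 the quadratic form ‖Δ₀ω‖² = ‖Δ₀ω + aQ′₁*Q′₁ω‖² is bounded from below by γ′₀²‖ω‖² because the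
  operator Δ₀ + aQ′₁*Q′₁ is bounded from below by γ′₀ > 0 (in fact we may get γ′₀ = π²/L²). Hence
  γ₀‖ω‖² ≤ ⟨ω, Δ′_jω⟩ ≤ γ₁‖ω‖² for ω : Q′₁ω = 0, (2.110) with positive constants γ₀, γ₁ dependent on d and L only.
  From the theorem on unit lattice operators in [3] it follows that a covariance C′^{(j)}_Λ of the last Gaussian
  integrals in (2.106) is a bounded operator with an exponential decay independent of j and Λ."*
* B6 pp. 249–250 [PDF 27–28] (the same scheme, written out at (S5); the passage starts at the bottom of p. 249 and
  continues on p. 250 from "operator, and we have"): *"An easy way to get a useful representation for C^{(k)}_Λ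
  is to get rid of the unnecessary variables in the integral above. We remove the variables B_b for b ⊂ Γ_{y,x} using
  the δ-functions δ_{Ax}(B). Next we remove the variables B_{b₀}, where b₀ is a bond belonging to B(c) for some c ∈ Λ′,
  and contained in c, using the δ-functions δ((QB)(c)). If we denote the remaining variables by B′, then we can write
  B = CB′, where C is a linear operator, and we have … (2.155) hence C^{(k)}_Λ = C(C*Δ_kC)⁻¹C*. (2.156) … C is a
  short-ranged operator, so C*Δ_kC has the same exponential decay as Δ_k. Now we may apply the theory developed in
  Sect. 5 of [3] on unit lattice operators."*

THE READING (a labelled modelling step, cell DIVERGENCE D-b06.10; nothing of it is a cited fact).  At (S2) the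
variables are the values ω(x), x ∈ Λ, of a REAL unit-lattice function (N = 1 component; B5 p. 18: *"A guage
transformation is determined by a real valued function λ : T_ε → R"*; p. 240: *"The configurations ω, ω′ are defined
on Λ"*), Λ a union of blocks B(y), y ∈ Λ′ — (2.89) p. 239 *"B^j(Λ) = □̃² ∩ B^{j+1}(Λ_{j+1})"* rescaled to the unit
lattice (p. 240: *"replaced by ξ = L^{−j}. For simplicity of notation let us omit ξ and □ in the formulas below"*), the
constraints being indexed by the L-lattice points Λ′ ((2.104): *"Q′₁μ = 0 on Λ′"*; (2.97): *"Σ_{c∈Λ′} |(Q_{j+1}A)(c)|²"*);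
the constraint δ(Q′₁ω) is the family of |Λ′| linear equations Σ_{x∈B(y)} ω(x) = 0, y ∈ Λ′ — NOT a coordinate
subspace.  Following p. 249 word for word ("we remove the variables B_{b₀} … using the δ-functions"), we
remove ONE variable per block, the value at the block's own L-lattice point y ∈ B(y) (its "corner", y_μ ≤ x_μ), by
ω(y) = −Σ_{x∈B(y), x≠y} ω(x), and keep the remaining values ω′ = ω↾{x ∈ Λ : x not a corner} as free variables:
ω = Cω′ with C(x, x′) = 1 if x = x′, = −1 if x is the corner of the block of x′, = 0 otherwise (`elimKer`, `elim`).
The lattice T₁ is read as Z^d (B4 types the theorem of [3] on finite Ω ⊂ Z^d, typing remark (iii) of `…B6FromB4`),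
the block of x ∈ Z^d is the one with corner (L⌊x_μ/L⌋)_μ (`corner`), and "|y − y′|" is the sup-distance of Z^d as in
`…B4`.  The covariance of the last Gaussian integrals in (2.106) in these coordinates is C(C*Δ′_jC)⁻¹C* by the
computation (2.155) — this is `B6FromB4.Reduction.cov` BY DEFINITION there (its docstring: "likewise C′^{(j)}_Λ of
(2.106) … by the same computation (2.155)"); the present module adds that C is a linear BIJECTION of the free
coordinates onto ker Q′₁ (`blockSum_elim_mulVec`, `elim_restr`, `restr_elim`), which is what (2.155) uses.

WHAT IS KERNEL-CHECKED HERE (finite combinatorics of blocks + matrix arithmetic; imports `Mathlib`, `…B6FromB4`):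
(1) blocks: `mem_block`, `mem_block_corner_iff` (x ∈ B(y) ⇔ corner x = y for y ∈ LZ^d), `card_block` (|B(y)| = L^d),
    `dist_le_of_corner_eq` (two points of one block are at sup-distance ≤ L − 1), `blockClosed_region` (a union of
    blocks ⋃_{y∈Λ′} B(y) is closed under "same block");
(2) the elimination: `blockSum_elim_mulVec` — Q′₁(Cω′) = 0 for every ω′ (range C ⊆ ker Q′₁); `elim_restr` — for ω with
    Q′₁ω = 0, C(ω↾free) = ω (ker Q′₁ ⊆ range C, with the coordinate projection as inverse); `restr_elim` — (Cω′)↾free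
    = ω′; `elim_iso` — ‖ω′‖² ≤ ‖Cω′‖² ((2.157)-type second inequality: "B′ are some of the coordinates of CB′");
    `elim_range` — C(x, x′) ≠ 0 ⇒ |x − x′|_∞ ≤ L − 1; `elim_col` — Σ_x |C(x, x′)| ≤ 2; `elim_row` — Σ_{x′} |C(x, x′)|
    ≤ L^d: the three numbers behind p. 250's *"C is a short-ranged operator"*, which the print does not display;
(3) the packaging `kerReduction L Λ Δ : B6FromB4.Reduction d 1 1` (Ω = Λ, Ω′ = the free sites, C = `elim`) and
    `kerReduction_printed`: Δ symmetric with kernel decay (c₀, δ₀) and the lower bound (2.110) γ₀‖ω‖² ≤ ⟨ω, Δω⟩ ON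
    ker Q′₁ give `Reduction.Printed γ₀ c₀ δ₀ (L − 1) (L^d + 1)`; hence
(4) `site242_uniform`: from `B4.Sect5ThmUniform d 1` (the theorem of [3], uniform reading, consumed as a hypothesis)
    there are ONE c and ONE δ — chosen after (d, L, γ₀, c₀, δ₀) and BEFORE the region and the operator — such that for
    EVERY union of blocks Λ and EVERY symmetric Δ on L²(Λ) with |Δ(y, y′)| ≤ c₀e^{−δ₀|y−y′|} and (2.110) on ker Q′₁, the
    covariance C(C*ΔC)⁻¹C* satisfies |C′(y, y′)| ≤ c·e^{−δ|y−y′|}: the sentence of p. 242 with "independent of j and Λ"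
    as the quantifier order ∃(c, δ) ∀(Λ, Δ′_j).
WHAT REMAINS A NAMED HYPOTHESIS (the located residuals; nothing of it is asserted here): `B4.Sect5ThmUniform d 1`
itself ([3] Sect. 5, census C-B4-3); per j, the two printed-shape inputs on Δ = Δ′_j — the lower bound (2.110) with
γ₀ = γ₀(d, L) (B6 displays it and gives the reason, γ′₀ = π²/L²; typed `LowerOnKer`) and *"an exponential decay of
Δ′_j(y − y′)"* with (c₀, δ₀) independent of j (said, not displayed; read off (2.108) by "the analyticity method
described in [3]" = residual (c) of G-B6-05a = GAPS G-B4-02, strip lemma supplied in `…B4Strip`; typed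
`KernelDecay`) and the symmetry of Δ′_j = H′_j*Δ²H′_j (evident from (2.107)).  The module `Beta/ConstraintElimination`
(unit pv03-g3) treats the companion elimination B′ = CB̃ of [Balaban1985BackgroundPropagators] (3.157) /
[Balaban1987RG1] p. 268 in abstract adapted coordinates σ ⊕ κ (`elim Q_σ Q_κ = [1; −Q_κ⁻¹Q_σ]`, determinant
identities); the present C is that operator for the site constraint Q′₁ with Q_κ = L^{−d}·1 (diagonal), written on the
lattice so that its LOCALITY constants — the input of `B6FromB4.sandwich_decay` — can be proved.

TYPING REMARKS (DIVERGENCE D-b06.10).  (i) T₁ ↦ Z^d, Λ finite (as in `…B4`, D-b04.5); on a torus the blocks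
wrap and `corner` would be taken mod the period — not typed (cf. `…B6FromB4` remark (iii)).  (ii) N = 1: ω is real
valued at (S2).  (iii) C* ↦ Cᵀ (real matrices).  (iv) The eliminated site of B(y) is its L-lattice point y (any
other choice gives another parametrization C₂ = C·G with G invertible and the same covariance; not needed).  (v) The
bond version of pp. 249–250 (constraints QB = 0 of B5 (1.11) and B(Γ_{y,x}) = 0 of B5 (1.10), pivot b₀(c) = the bond of
B(c₋) contained in c) is a triangular elimination of the same kind whose locality constants depend on d and L only;
it is NOT typed here because its free index set (bonds minus tree bonds minus pivots) is not of the product form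
Ω′ × Fin N′ of `B6FromB4.Reduction` (typing remark (i) there: a padded block-diagonal extension A ⊕ γI is needed
before the theorem of [3] applies as typed) — recorded as the (S5) part of the residual, not claimed.

Value = kernel-checked construction closing a located residual at the level of the implication + the residual
analytic leaves named as hypotheses, NOT summit progress.  Cell pub-balaban, unit `b2b-balaban-b06-g3` (paper
sub-cell B06, gen 3); census rows GAPS C-b06g3-1 (closes G-pv09g2-1 (iii) / G-B6-07 residual (b)), DIVERGENCE D-b06.10.
v1.1 (DOCFIX, docstring-only; every declaration byte-identical to v1, p177738): the page tag of the (S5) passage is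
pp. 249–250 (v1 wrote p. 250: the passage begins at the bottom of p. 249); the two B9 p. 428 quotations now carry the
key [Balaban1985BackgroundPropagators] (CMP 99:389–434) — v1's "[Balaban1985]" resolves in references.bib to CMP
102:277–309, which has no p. 428 (cross-read pv14, GAPS C-pv14-19 / G-pv14-4; cell erratum E-b06g3-1).  The bond
version of remark (v) is the sibling module `…B6BondElimination` of this unit.
-/

namespace Literature.MathematicalPhysics.QuantumFieldTheory.Balaban1983to89.B6Elimination

open Literature.MathematicalPhysics.QuantumFieldTheory.Balaban1983to89
open Finset
open scoped Matrix

noncomputable section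

variable {d : ℕ}

/-! ## §1  The blocks B(y) of B5 (1.6) on Z^d -/

section Blocks

variable {L : ℕ}

/-- The L-lattice point ("corner") y ∈ LZ^d of the block B(y) ∋ x of B5 (1.6): y_μ = L⌊x_μ/L⌋, so that
y_μ ≤ x_μ < y_μ + L. [cite: Balaban1984PropagatorsI, (1.6) p.18] -/
def corner (L : ℕ) (x : Fin d → ℤ) : Fin d → ℤ := fun i => (L : ℤ) * (x i / (L : ℤ))

/-- B5 (1.6) verbatim: *"B(y) = {x ∈ T₁ : y_μ ≤ x_μ < y_μ + L, μ = 1, …, d}"* (T₁ read as Z^d).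
[cite: Balaban1984PropagatorsI, (1.6) p.18] -/
def block (L : ℕ) (y : Fin d → ℤ) : Finset (Fin d → ℤ) :=
  Fintype.piFinset fun i => Finset.Ico (y i) (y i + L)

/-- Membership in B(y) is the printed pair of inequalities. [cite: Balaban1984PropagatorsI, (1.6) p.18] -/
theorem mem_block {y x : Fin d → ℤ} : x ∈ block L y ↔ ∀ i, y i ≤ x i ∧ x i < y i + L := by
  simp only [block, Fintype.mem_piFinset, Finset.mem_Ico]

/-- Componentwise formula of the corner. [folklore] -/
theorem corner_apply (x : Fin d → ℤ) (i : Fin d) : corner L x i = (L : ℤ) * (x i / (L : ℤ)) := rfl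

/-- y_μ ≤ x_μ for the corner y of the block of x. [folklore] -/
theorem corner_le (hL : 0 < L) (x : Fin d → ℤ) (i : Fin d) : corner L x i ≤ x i := by
  have h1 := Int.emod_nonneg (x i) (show (L : ℤ) ≠ 0 by exact_mod_cast hL.ne')
  have h2 := Int.emod_def (x i) (L : ℤ)
  rw [corner_apply]
  linarith

/-- x_μ < y_μ + L for the corner y of the block of x. [folklore] -/
theorem lt_corner_add (hL : 0 < L) (x : Fin d → ℤ) (i : Fin d) : x i < corner L x i + L := by
  have h1 := Int.emod_lt_of_pos (x i) (show (0 : ℤ) < L by exact_mod_cast hL)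
  have h2 := Int.emod_def (x i) (L : ℤ)
  rw [corner_apply]
  linarith

/-- x ∈ B(corner x). [folklore] -/
theorem mem_block_corner (hL : 0 < L) (x : Fin d → ℤ) : x ∈ block L (corner L x) :=
  mem_block.2 fun i => ⟨corner_le hL x i, lt_corner_add hL x i⟩

/-- The corner of a corner is itself (corners are the L-lattice points). [folklore] -/
theorem corner_corner (hL : 0 < L) (x : Fin d → ℤ) : corner L (corner L x) = corner L x := by
  funext i
  have h : (L : ℤ) ≠ 0 := by exact_mod_cast hL.ne'
  rw [corner_apply, corner_apply, Int.mul_ediv_cancel_left _ h]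

/-- A point of the block with corner `corner k` has the same corner. [folklore] -/
theorem corner_eq_of_mem_block (hL : 0 < L) {x k : Fin d → ℤ} (h : x ∈ block L (corner L k)) :
    corner L x = corner L k := by
  rw [mem_block] at h
  funext i
  obtain ⟨h1, h2⟩ := h i
  rw [corner_apply] at h1 h2 ⊢
  rw [corner_apply]
  have hL' : (0 : ℤ) < L := by exact_mod_cast hL
  have e1 : k i / (L : ℤ) ≤ x i / (L : ℤ) := Int.le_ediv_of_mul_le hL' (by linarith)
  have e2 : x i / (L : ℤ) < k i / (L : ℤ) + 1 := Int.ediv_lt_of_lt_mul hL' (by linarith)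
  congr 1
  omega

/-- x ∈ B(corner k) ⇔ corner x = corner k: blocks are the fibres of `corner`. [folklore] -/
theorem mem_block_corner_iff (hL : 0 < L) {x k : Fin d → ℤ} :
    x ∈ block L (corner L k) ↔ corner L x = corner L k :=
  ⟨corner_eq_of_mem_block hL, fun h => by rw [← h]; exact mem_block_corner hL x⟩

/-- An L-lattice point is its own corner: for y ∈ LZ^d the block `block L y` is B(y) of (1.6) and `corner` labels it
by y. [folklore] -/
theorem corner_eq_self_of_dvd (y : Fin d → ℤ) (hy : ∀ i, (L : ℤ) ∣ y i) : corner L y = y := by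
  funext i
  rw [corner_apply]
  exact Int.mul_ediv_cancel' (hy i)

/-- |B(y)| = L^d. [folklore] -/
theorem card_block (y : Fin d → ℤ) : (block L y).card = L ^ d := by
  simp [block, Fintype.card_piFinset, Int.card_Ico, Finset.prod_const]

/-- Two points of one block are at sup-distance ≤ L − 1 (the range of the elimination matrix). [folklore] -/
theorem dist_le_of_corner_eq (hL : 0 < L) {x x' : Fin d → ℤ} (h : corner L x = corner L x') :
    dist x x' ≤ (L : ℝ) - 1 := by
  have hL1 : (1 : ℝ) ≤ L := by exact_mod_cast hL
  refine (dist_pi_le_iff (by linarith)).2 fun i => ?_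
  rw [Int.dist_eq]
  have a1 := corner_le hL x i
  have a2 := lt_corner_add hL x i
  have b1 := corner_le hL x' i
  have b2 := lt_corner_add hL x' i
  have hc : corner L x i = corner L x' i := by rw [h]
  rw [abs_le]
  constructor
  · have h3 : -((L : ℤ) - 1) ≤ x i - x' i := by omega
    have h4 := (Int.cast_le (R := ℝ)).2 h3
    push_cast at h4
    linarith
  · have h3 : x i - x' i ≤ (L : ℤ) - 1 := by omega
    have h4 := (Int.cast_le (R := ℝ)).2 h3
    push_cast at h4
    linarith

/-- "Λ is a union of blocks B(y)": closed under passing to any point of the same block.  This is the shape of the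
regions at (S2): (2.89) *"B^j(Λ) = □̃² ∩ B^{j+1}(Λ_{j+1})"* rescaled to the unit lattice, Λ = ⋃_{y∈Λ′} B(y) with the
constraints *"Q′₁μ = 0 on Λ′"* (2.104). [cite: Balaban1984PropagatorsII, (2.89) p.239 + (2.104) p.241] -/
def BlockClosed (L : ℕ) (Λ : Finset (Fin d → ℤ)) : Prop :=
  ∀ x ∈ Λ, ∀ x', corner L x' = corner L x → x' ∈ Λ

/-- A union of blocks contains the corner of each of its points. [folklore] -/
theorem BlockClosed.corner_mem {Λ : Finset (Fin d → ℤ)} (h : BlockClosed L Λ) (hL : 0 < L)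
    {x : Fin d → ℤ} (hx : x ∈ Λ) : corner L x ∈ Λ :=
  h x hx _ (corner_corner hL x)

/-- The region Λ = ⋃_{y∈Λ′} B(y) of a finite set Λ′ of L-lattice points (for y ∉ LZ^d the block of y is used).
[cite: Balaban1984PropagatorsII, (2.89) p.239] -/
def region (L : ℕ) (Λ' : Finset (Fin d → ℤ)) : Finset (Fin d → ℤ) :=
  Λ'.biUnion fun y => block L (corner L y)

/-- ⋃_{y∈Λ′} B(y) is a union of blocks. [folklore] -/
theorem blockClosed_region (hL : 0 < L) (Λ' : Finset (Fin d → ℤ)) : BlockClosed L (region L Λ') := by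
  intro x hx x' hx'
  simp only [region, Finset.mem_biUnion] at hx ⊢
  obtain ⟨y, hy, hxy⟩ := hx
  refine ⟨y, hy, ?_⟩
  rw [mem_block_corner_iff hL] at hxy ⊢
  rw [hx', hxy]

end Blocks

/-! ## §2  Functions on Λ as vectors indexed by `B4.Idx Λ 1`; the constraint Q′₁ω = 0 -/

section Indexing

variable {L : ℕ} {Ω : Finset (Fin d → ℤ)}

/-- A vector indexed by `B4.Idx Ω 1 = Ω × Fin 1` as a function on Z^d (zero off Ω). [folklore] -/
def toSite (v : B4.Idx Ω 1 → ℝ) : (Fin d → ℤ) → ℝ :=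
  fun x => if h : x ∈ Ω then v (⟨x, h⟩, 0) else 0

/-- `toSite v` at the position of an index is the value of v. [folklore] -/
theorem toSite_apply (v : B4.Idx Ω 1 → ℝ) (p : B4.Idx Ω 1) : toSite v (p.1 : Fin d → ℤ) = v p := by
  obtain ⟨⟨x, hx⟩, t⟩ := p
  obtain rfl : t = 0 := Subsingleton.elim _ _
  simp [toSite, hx]

/-- `toSite v` vanishes off Ω. [folklore] -/
theorem toSite_of_not_mem (v : B4.Idx Ω 1 → ℝ) {x : Fin d → ℤ} (hx : x ∉ Ω) : toSite v x = 0 := by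
  simp [toSite, hx]

/-- A sum over the indices `Ω × Fin 1` of a function of the position is the sum over the sites of Ω. [folklore] -/
theorem sum_idx (g : (Fin d → ℤ) → ℝ) : ∑ p : B4.Idx Ω 1, g (p.1 : Fin d → ℤ) = ∑ x ∈ Ω, g x := by
  rw [Fintype.sum_prod_type, ← Finset.sum_coe_sort Ω g]
  simp

/-- L^d · (Q′₁v)(y) = Σ_{x ∈ B(y)} v(x), the block sum of v over the block with corner y (B5 (1.13): (Q′λ)(y) =
Σ_{x∈B(y)} L^{−d}λ(x)). [cite: Balaban1984PropagatorsI, (1.13) p.19] -/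
def blockSum (L : ℕ) (v : B4.Idx Ω 1 → ℝ) (y : Fin d → ℤ) : ℝ :=
  ∑ p : B4.Idx Ω 1, if corner L (p.1 : Fin d → ℤ) = y then v p else 0

/-- (Q′₁v)(y) verbatim, B5 (1.13): Σ_{x∈B(y)} L^{−d}v(x) (for v supported in Ω). [cite: Balaban1984PropagatorsI, (1.13) p.19] -/
def blockAvg (L : ℕ) (v : B4.Idx Ω 1 → ℝ) (y : Fin d → ℤ) : ℝ :=
  ∑ p : B4.Idx Ω 1, if corner L (p.1 : Fin d → ℤ) = y then ((L : ℝ) ^ d)⁻¹ * v p else 0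

/-- Q′₁v = L^{−d} · block sums. [folklore] -/
theorem blockAvg_eq (v : B4.Idx Ω 1 → ℝ) (y : Fin d → ℤ) :
    blockAvg L v y = ((L : ℝ) ^ d)⁻¹ * blockSum L v y := by
  simp only [blockAvg, blockSum, Finset.mul_sum, mul_ite, mul_zero]

/-- The constraint of (2.106), *"δ(Q′₁ω)"*, is the vanishing of the block sums. [cite: Balaban1984PropagatorsII, (2.106) p.242] -/
theorem blockAvg_eq_zero_iff (hL : 0 < L) (v : B4.Idx Ω 1 → ℝ) (y : Fin d → ℤ) :
    blockAvg L v y = 0 ↔ blockSum L v y = 0 := by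
  rw [blockAvg_eq, mul_eq_zero, or_iff_right]
  exact inv_ne_zero (pow_ne_zero _ (by exact_mod_cast hL.ne'))

/-- The block sum as a sum over sites. [folklore] -/
theorem blockSum_eq (v : B4.Idx Ω 1 → ℝ) (y : Fin d → ℤ) :
    blockSum L v y = ∑ x ∈ Ω, if corner L x = y then toSite v x else 0 := by
  simp only [blockSum]
  rw [← sum_idx (Ω := Ω) (fun x => if corner L x = y then toSite v x else 0)]
  simp only [toSite_apply]

end Indexing

/-! ## §3  The elimination matrix C of (S2): ω = Cω′, one variable per block removed "using the δ-functions" -/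

section Elimination

variable {L : ℕ} {Λ : Finset (Fin d → ℤ)}

/-- The sites kept as free variables ω′ (p. 249: *"If we denote the remaining variables by B′"*): all sites of Λ
except the L-lattice points (block corners), whose variables are removed by the constraint.
[cite: Balaban1984PropagatorsII, p.249] -/
def free (L : ℕ) (Λ : Finset (Fin d → ℤ)) : Finset (Fin d → ℤ) := Λ.filter fun x => x ≠ corner L x

/-- The free sites lie in Λ. [folklore] -/
theorem free_subset : free L Λ ⊆ Λ := Finset.filter_subset _ _

/-- Membership in the free sites. [folklore] -/
theorem mem_free {x : Fin d → ℤ} : x ∈ free L Λ ↔ x ∈ Λ ∧ x ≠ corner L x := Finset.mem_filter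

/-- The kernel of C: C(x, x′) = 1 if x = x′, −1 if x is the corner of the block of x′ (the removed variable of that
block, solved from Σ_{B(y)} ω = 0), 0 otherwise. [cite: Balaban1984PropagatorsII, pp.249–250] -/
def elimKer (L : ℕ) (x k : Fin d → ℤ) : ℝ :=
  if x = k then 1 else if x = corner L k then -1 else 0

/-- *"we can write B = CB′, where C is a linear operator"* — here ω = Cω′ for the site constraint Q′₁ω = 0 of (S2):
the matrix C from the free variables (indexed by `free L Λ × Fin 1`) to all variables (`Λ × Fin 1`).
[cite: Balaban1984PropagatorsII, pp.249–250, (2.155)–(2.156) p.250] -/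
def elim (L : ℕ) (Λ : Finset (Fin d → ℤ)) : Matrix (B4.Idx Λ 1) (B4.Idx (free L Λ) 1) ℝ :=
  Matrix.of fun p k => elimKer L (p.1 : Fin d → ℤ) (k.1 : Fin d → ℤ)

/-- Entry formula of C. [folklore] -/
theorem elim_apply (p : B4.Idx Λ 1) (k : B4.Idx (free L Λ) 1) :
    elim L Λ p k = elimKer L (p.1 : Fin d → ℤ) (k.1 : Fin d → ℤ) := rfl

/-- (Cω′)(x) as a sum over the free sites. [folklore] -/
theorem elim_mulVec_apply (w : B4.Idx (free L Λ) 1 → ℝ) (p : B4.Idx Λ 1) :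
    (elim L Λ *ᵥ w) p = ∑ z ∈ free L Λ, elimKer L (p.1 : Fin d → ℤ) z * toSite w z := by
  simp only [Matrix.mulVec, dotProduct, elim_apply]
  rw [← sum_idx (Ω := free L Λ) (fun z => elimKer L (p.1 : Fin d → ℤ) z * toSite w z)]
  simp only [toSite_apply]

/-- The column of C at a free site x′ has zero sum over every block: the +1 at x′ and the −1 at the corner of the
block of x′ lie in the same block (and the corner belongs to Λ, a union of blocks). [folklore] -/
theorem elimKer_blockSum (hL : 0 < L) (hΛ : BlockClosed L Λ) {k : Fin d → ℤ} (hk : k ∈ free L Λ)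
    (y : Fin d → ℤ) : ∑ x ∈ Λ, (if corner L x = y then elimKer L x k else 0) = 0 := by
  obtain ⟨hkΛ, hkc⟩ := mem_free.1 hk
  have hcΛ : corner L k ∈ Λ := hΛ.corner_mem hL hkΛ
  set c : ℝ := if corner L k = y then 1 else 0 with hc
  have key : ∀ x ∈ Λ, (if corner L x = y then elimKer L x k else 0) =
      (if x = k then c else 0) - (if x = corner L k then c else 0) := by
    intro x _
    by_cases h1 : x = k
    · have hx2 : x ≠ corner L k := by rw [h1]; exact hkc
      rw [if_pos h1, if_neg hx2, sub_zero, hc, h1]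
      simp [elimKer]
    · by_cases h2 : x = corner L k
      · have hne : corner L k ≠ k := Ne.symm hkc
        rw [if_neg h1, if_pos h2, zero_sub, hc, h2, corner_corner hL]
        by_cases h3 : corner L k = y
        · rw [if_pos h3, if_pos h3]
          simp [elimKer, hne]
        · rw [if_neg h3, if_neg h3, neg_zero]
      · rw [if_neg h1, if_neg h2, sub_zero]
        simp [elimKer, h1, h2]
  rw [Finset.sum_congr rfl key, Finset.sum_sub_distrib, Finset.sum_ite_eq', Finset.sum_ite_eq', if_pos hkΛ,
    if_pos hcΛ, sub_self]

/-- RANGE C ⊆ ker Q′₁: *"By the definition of C we have of course that … QCB′ = 0 … for arbitrary B′"* — here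
Q′₁(Cω′) = 0 for arbitrary ω′ (all block sums of Cω′ vanish). [cite: Balaban1984PropagatorsII, p.250] -/
theorem blockSum_elim_mulVec (hL : 0 < L) (hΛ : BlockClosed L Λ) (w : B4.Idx (free L Λ) 1 → ℝ)
    (y : Fin d → ℤ) : blockSum L (elim L Λ *ᵥ w) y = 0 := by
  simp only [blockSum, elim_mulVec_apply]
  rw [sum_idx (Ω := Λ)
    (fun x => if corner L x = y then ∑ z ∈ free L Λ, elimKer L x z * toSite w z else 0)]
  have hx : ∀ x ∈ Λ, (if corner L x = y then ∑ z ∈ free L Λ, elimKer L x z * toSite w z else 0) =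
      ∑ z ∈ free L Λ, (if corner L x = y then elimKer L x z else 0) * toSite w z := by
    intro x _
    split_ifs <;> simp
  rw [Finset.sum_congr rfl hx, Finset.sum_comm]
  refine Finset.sum_eq_zero fun z hz => ?_
  rw [← Finset.sum_mul, elimKer_blockSum hL hΛ hz y, zero_mul]

/-- Q′₁(Cω′) = 0 in the printed normalisation (1.13). [cite: Balaban1984PropagatorsII, p.250] -/
theorem blockAvg_elim_mulVec (hL : 0 < L) (hΛ : BlockClosed L Λ) (w : B4.Idx (free L Λ) 1 → ℝ)
    (y : Fin d → ℤ) : blockAvg L (elim L Λ *ᵥ w) y = 0 :=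
  (blockAvg_eq_zero_iff hL _ y).2 (blockSum_elim_mulVec hL hΛ w y)

/-- At a free site x, (Cω′)(x) = ω′(x): C is the identity on the kept variables (B9 = [Balaban1985BackgroundPropagators],
CMP 99, p. 428 [PDF 40], recalling this construction of B6 = its [4], "in the same way as in [4] (2.154–2.155)":
*"It is an identity operator on almost all bonds, except the bonds b₀"*). [cite: Balaban1984PropagatorsII, p.250] -/
theorem elim_mulVec_free (hL : 0 < L) (w : B4.Idx (free L Λ) 1 → ℝ) (p : B4.Idx Λ 1)
    (hp : (p.1 : Fin d → ℤ) ∈ free L Λ) : (elim L Λ *ᵥ w) p = toSite w (p.1 : Fin d → ℤ) := by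
  obtain ⟨_, hpc⟩ := mem_free.1 hp
  rw [elim_mulVec_apply, Finset.sum_eq_single_of_mem (p.1 : Fin d → ℤ) hp]
  · simp [elimKer]
  · intro z hz hne
    obtain ⟨_, hzc⟩ := mem_free.1 hz
    have h2 : (p.1 : Fin d → ℤ) ≠ corner L z := by
      intro h
      apply hpc
      rw [h, corner_corner hL]
    simp [elimKer, Ne.symm hne, h2]

/-- The coordinates ω′ = ω↾(free sites) of a configuration ω on Λ. [folklore] -/
def restr (L : ℕ) (Λ : Finset (Fin d → ℤ)) (ω : B4.Idx Λ 1 → ℝ) : B4.Idx (free L Λ) 1 → ℝ :=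
  fun q => ω (B4.inclIdx free_subset q)

/-- `toSite` of the restriction agrees with `toSite ω` on the free sites. [folklore] -/
theorem toSite_restr (ω : B4.Idx Λ 1 → ℝ) {z : Fin d → ℤ} (hz : z ∈ free L Λ) :
    toSite (restr L Λ ω) z = toSite ω z := by
  have hzΛ : z ∈ Λ := free_subset hz
  simp [toSite, restr, hz, hzΛ, B4.inclIdx]

/-- ker Q′₁ ⊆ RANGE C, with the explicit inverse: if all block sums of ω vanish then C(ω↾free) = ω — the removed
variable of each block is recovered as minus the sum of the kept ones (*"a value (CB̃)(b₀) is equal to a solution of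
the equation (QB)(c) = 0, considered as an equation on the variable B(b₀)"*, [Balaban1985BackgroundPropagators] = B9,
CMP 99, p. 428; here for Q′₁).
[cite: Balaban1984PropagatorsII, (2.155) p.250] -/
theorem elim_restr (hL : 0 < L) {ω : B4.Idx Λ 1 → ℝ}
    (hω : ∀ y, blockSum L ω y = 0) : elim L Λ *ᵥ restr L Λ ω = ω := by
  funext p
  have hpΛ : (p.1 : Fin d → ℤ) ∈ Λ := p.1.2
  by_cases hpc : (p.1 : Fin d → ℤ) = corner L (p.1 : Fin d → ℤ)
  · -- p is a corner: its value is minus the sum over the free sites of its block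
    rw [elim_mulVec_apply, Finset.sum_congr rfl (fun z hz => by rw [toSite_restr ω hz])]
    have hzero := hω (p.1 : Fin d → ℤ)
    rw [blockSum_eq, ← Finset.sum_filter_add_sum_filter_not Λ (fun x => x ≠ corner L x)] at hzero
    have h2 : ∑ x ∈ Λ.filter (fun x => ¬ (x ≠ corner L x)),
        (if corner L x = (p.1 : Fin d → ℤ) then toSite ω x else 0) = ω p := by
      have h2a : ∀ x ∈ Λ.filter (fun x => ¬ (x ≠ corner L x)),
          (if corner L x = (p.1 : Fin d → ℤ) then toSite ω x else 0) =
            (if x = (p.1 : Fin d → ℤ) then toSite ω x else 0) := by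
        intro x hx
        have hxc : x = corner L x := by simpa using (Finset.mem_filter.1 hx).2
        have hiff : corner L x = (p.1 : Fin d → ℤ) ↔ x = (p.1 : Fin d → ℤ) := by
          constructor
          · intro h; rw [hxc, h]
          · intro h; rw [h]; exact hpc.symm
        simp only [hiff]
      rw [Finset.sum_congr rfl h2a, Finset.sum_ite_eq', if_pos (Finset.mem_filter.2 ⟨hpΛ, by simpa using hpc⟩),
        toSite_apply]
    rw [h2] at hzero
    have h3 : ∀ z ∈ free L Λ, elimKer L (p.1 : Fin d → ℤ) z * toSite ω z =
        -(if corner L z = (p.1 : Fin d → ℤ) then toSite ω z else 0) := by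
      intro z hz
      obtain ⟨_, hzc⟩ := mem_free.1 hz
      have h1 : (p.1 : Fin d → ℤ) ≠ z := by
        intro h
        apply hzc
        rw [← h, ← hpc]
      by_cases h4 : corner L z = (p.1 : Fin d → ℤ)
      · simp [elimKer, h1, h4]
      · simp [elimKer, h1, h4, Ne.symm h4]
    rw [Finset.sum_congr rfl h3, Finset.sum_neg_distrib]
    have : free L Λ = Λ.filter (fun x => x ≠ corner L x) := rfl
    rw [this]
    linarith
  · -- p is a free site
    rw [elim_mulVec_free hL _ p (mem_free.2 ⟨hpΛ, hpc⟩), toSite_restr ω (mem_free.2 ⟨hpΛ, hpc⟩), toSite_apply]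

/-- (Cω′)↾free = ω′: the free variables are coordinates of Cω′. [folklore] -/
theorem restr_elim (hL : 0 < L) (w : B4.Idx (free L Λ) 1 → ℝ) : restr L Λ (elim L Λ *ᵥ w) = w := by
  funext q
  simp only [restr]
  rw [elim_mulVec_free hL w _ (by exact q.1.2)]
  exact toSite_apply w q

/-- The index inclusion free ⊆ Λ is injective. [folklore] -/
theorem inclIdx_free_injective : Function.Injective (B4.inclIdx (N := 1) (free_subset (L := L) (Λ := Λ))) := by
  rintro ⟨⟨x, hx⟩, i⟩ ⟨⟨y, hy⟩, j⟩ hpq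
  simp only [B4.inclIdx, Prod.mk.injEq, Subtype.mk.injEq] at hpq
  obtain ⟨rfl, rfl⟩ := hpq
  rfl

/-- ‖ω′‖² ≤ ‖Cω′‖² — the second inequality of (2.157) in its (S2) form (*"≥ γ′₀‖B′‖²"*: the free variables are some
of the coordinates of Cω′). [cite: Balaban1984PropagatorsII, (2.157) p.250] -/
theorem elim_iso (hL : 0 < L) (w : B4.Idx (free L Λ) 1 → ℝ) :
    ∑ q, w q ^ 2 ≤ ∑ p, (elim L Λ *ᵥ w) p ^ 2 := by
  calc ∑ q, w q ^ 2 = ∑ q, (elim L Λ *ᵥ w) (B4.inclIdx free_subset q) ^ 2 := by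
        refine Finset.sum_congr rfl fun q _ => ?_
        rw [elim_mulVec_free hL w _ (by exact q.1.2)]
        exact congrArg (· ^ 2) (toSite_apply w q).symm
    _ = ∑ p ∈ Finset.univ.image (B4.inclIdx (N := 1) free_subset), (elim L Λ *ᵥ w) p ^ 2 := by
        rw [Finset.sum_image fun a _ b _ h => inclIdx_free_injective h]
    _ ≤ ∑ p, (elim L Λ *ᵥ w) p ^ 2 :=
        Finset.sum_le_sum_of_subset_of_nonneg (Finset.subset_univ _) fun p _ _ => sq_nonneg _

/-- C is SHORT-RANGED with range L − 1: C(x, x′) ≠ 0 ⇒ x, x′ lie in one block ⇒ |x − x′|_∞ ≤ L − 1 (the number r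
behind p. 250's *"C is a short-ranged operator"*). [cite: Balaban1984PropagatorsII, p.250] -/
theorem elim_range (hL : 0 < L) (p : B4.Idx Λ 1) (k : B4.Idx (free L Λ) 1) (h : elim L Λ p k ≠ 0) :
    dist (p.1 : Fin d → ℤ) (k.1 : Fin d → ℤ) ≤ (L : ℝ) - 1 := by
  apply dist_le_of_corner_eq hL
  rw [elim_apply, elimKer] at h
  by_cases h1 : (p.1 : Fin d → ℤ) = k.1
  · rw [h1]
  · rw [if_neg h1] at h
    by_cases h2 : (p.1 : Fin d → ℤ) = corner L k.1
    · rw [h2, corner_corner hL]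
    · rw [if_neg h2] at h
      exact absurd rfl h

/-- Column ℓ¹-sums of C are ≤ 2 (one +1, one −1). [folklore] -/
theorem elim_col (k : B4.Idx (free L Λ) 1) : ∑ p, |elim L Λ p k| ≤ 2 := by
  have hb : ∀ p : B4.Idx Λ 1, |elim L Λ p k| ≤
      (if (p.1 : Fin d → ℤ) = k.1 then (1 : ℝ) else 0) +
        (if (p.1 : Fin d → ℤ) = corner L k.1 then (1 : ℝ) else 0) := by
    intro p
    rw [elim_apply, elimKer]
    split_ifs <;> norm_num
  refine (Finset.sum_le_sum fun p _ => hb p).trans ?_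
  rw [Finset.sum_add_distrib,
    sum_idx (Ω := Λ) (fun x => if x = (k.1 : Fin d → ℤ) then (1 : ℝ) else 0),
    sum_idx (Ω := Λ) (fun x => if x = corner L (k.1 : Fin d → ℤ) then (1 : ℝ) else 0),
    Finset.sum_ite_eq', Finset.sum_ite_eq']
  split_ifs <;> norm_num

/-- Row ℓ¹-sums of C are ≤ L^d (a corner row carries −1 at each free site of its block). [folklore] -/
theorem elim_row (hL : 0 < L) (p : B4.Idx Λ 1) : ∑ k, |elim L Λ p k| ≤ (L : ℝ) ^ d := by
  have hb : ∀ k : B4.Idx (free L Λ) 1, |elim L Λ p k| ≤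
      if (k.1 : Fin d → ℤ) ∈ block L (corner L (p.1 : Fin d → ℤ)) then (1 : ℝ) else 0 := by
    intro k
    rw [elim_apply, elimKer]
    by_cases h1 : (p.1 : Fin d → ℤ) = k.1
    · rw [if_pos h1, if_pos (by rw [← h1]; exact mem_block_corner hL _)]
      simp
    · rw [if_neg h1]
      by_cases h2 : (p.1 : Fin d → ℤ) = corner L k.1
      · rw [if_pos h2, if_pos (by rw [mem_block_corner_iff hL, h2, corner_corner hL])]
        simp
      · rw [if_neg h2]
        split_ifs <;> simp
  refine (Finset.sum_le_sum fun k _ => hb k).trans ?_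
  rw [sum_idx (Ω := free L Λ) (fun z => if z ∈ block L (corner L (p.1 : Fin d → ℤ)) then (1 : ℝ) else 0),
    ← Finset.sum_filter, Finset.sum_const, nsmul_eq_mul, mul_one]
  have : ((free L Λ).filter (fun z => z ∈ block L (corner L (p.1 : Fin d → ℤ)))).card ≤ L ^ d := by
    rw [← card_block (L := L) (corner L (p.1 : Fin d → ℤ))]
    exact Finset.card_le_card fun z hz => (Finset.mem_filter.1 hz).2
  exact_mod_cast this

end Elimination

/-! ## §4  (S2) as an instance of `B6FromB4.Reduction`: the p. 242 sentence -/

section Site242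

variable {L : ℕ}

/-- The lower bound (2.110) as a hypothesis shape: *"γ₀‖ω‖² ≤ ⟨ω, Δ′_jω⟩ … for ω : Q′₁ω = 0, (2.110) with positive
constants γ₀, γ₁ dependent on d and L only"* — for an operator Δ on L²(Λ), on the configurations with vanishing
block sums. [cite: Balaban1984PropagatorsII, (2.110) p.242] -/
def LowerOnKer (L : ℕ) (Λ : Finset (Fin d → ℤ)) (Δ : Matrix (B4.Idx Λ 1) (B4.Idx Λ 1) ℝ) (γ : ℝ) : Prop :=
  ∀ ω : B4.Idx Λ 1 → ℝ, (∀ y, blockSum L ω y = 0) → γ * ∑ p, ω p ^ 2 ≤ ∑ p, ω p * (Δ *ᵥ ω) p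

/-- *"an exponential decay of Δ′_j(y − y′)"* (p. 242, said not displayed) in the entrywise shape of [3] (5.6):
|Δ(y, y′)| ≤ c₀e^{−δ₀|y−y′|}. [cite: Balaban1984PropagatorsII, p.242] -/
def KernelDecay (Λ : Finset (Fin d → ℤ)) (Δ : Matrix (B4.Idx Λ 1) (B4.Idx Λ 1) ℝ) (c₀ δ₀ : ℝ) : Prop :=
  ∀ p q : B4.Idx Λ 1, |Δ p q| ≤ c₀ * Real.exp (-(δ₀ * dist (p.1 : Fin d → ℤ) (q.1 : Fin d → ℤ)))

/-- (S2) as ONE INSTANCE of the reduction scheme of `…B6FromB4`: variables ω on Λ (N = 1), free variables ω′ on the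
non-corner sites of Λ, the operator Δ (= Δ′_j of (2.107) restricted to Λ), and the elimination C.
[cite: Balaban1984PropagatorsII, (2.106)–(2.107) p.242] -/
def kerReduction (L : ℕ) (Λ : Finset (Fin d → ℤ)) (Δ : Matrix (B4.Idx Λ 1) (B4.Idx Λ 1) ℝ) :
    B6FromB4.Reduction d 1 1 where
  Ω := Λ
  Ω' := free L Λ
  Δ := Δ
  C := elim L Λ

/-- The covariance of the instance is C(C*ΔC)⁻¹C* — (2.156) read at (S2): the covariance C′^{(j)}_Λ of the last
Gaussian integrals in (2.106) in the coordinates ω = Cω′. [cite: Balaban1984PropagatorsII, (2.156) p.250] -/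
theorem kerReduction_cov (Λ : Finset (Fin d → ℤ)) (Δ : Matrix (B4.Idx Λ 1) (B4.Idx Λ 1) ℝ) :
    (kerReduction L Λ Δ).cov = elim L Λ * ((elim L Λ)ᵀ * Δ * elim L Λ)⁻¹ * (elim L Λ)ᵀ := rfl

/-- KERNEL-CHECKED: the printed-shape inputs of `B6FromB4.Reduction.Printed` hold for (S2) with the EXHIBITED C and
the constants r = L − 1, m = L^d + 1, given the three inputs B6 names for Δ′_j: symmetry, kernel decay (c₀, δ₀), and
(2.110) on ker Q′₁. [cite: Balaban1984PropagatorsII, (2.110) p.242 + p.250] -/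
theorem kerReduction_printed (hL : 0 < L) {Λ : Finset (Fin d → ℤ)} (hΛ : BlockClosed L Λ)
    {Δ : Matrix (B4.Idx Λ 1) (B4.Idx Λ 1) ℝ} {γ c₀ δ₀ : ℝ}
    (hs : Δ.IsSymm) (hd : KernelDecay Λ Δ c₀ δ₀) (hl : LowerOnKer L Λ Δ γ) :
    (kerReduction L Λ Δ).Printed γ c₀ δ₀ ((L : ℝ) - 1) ((L : ℝ) ^ d + 1) := by
  have h1 : (1 : ℝ) ≤ (L : ℝ) ^ d := one_le_pow₀ (by exact_mod_cast hL)
  exact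
    { symm := hs
      decay := hd
      lower := fun w => hl _ (blockSum_elim_mulVec hL hΛ w)
      iso := elim_iso hL
      range := elim_range hL
      col := fun k => (elim_col k).trans (by linarith)
      row := fun p => (elim_row hL p).trans (by linarith) }

/-- KERNEL-CHECKED, the sentence of p. 242 [PDF 20] as an instance of [3]: *"Hence γ₀‖ω‖² ≤ ⟨ω, Δ′_jω⟩ ≤ γ₁‖ω‖² for
ω : Q′₁ω = 0, (2.110) with positive constants γ₀, γ₁ dependent on d and L only. From the theorem on unit lattice
operators in [3] it follows that a covariance C′^{(j)}_Λ of the last Gaussian integrals in (2.106) is a bounded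
operator with an exponential decay independent of j and Λ."*  Given the Sect. 5 Theorem of [3] (uniform reading,
N = 1) and (d, L, γ₀, c₀, δ₀), there are ONE c and ONE δ such that for EVERY union of blocks Λ and EVERY symmetric Δ
on L²(Λ) with |Δ(y, y′)| ≤ c₀e^{−δ₀|y−y′|} and γ₀‖ω‖² ≤ ⟨ω, Δω⟩ on ker Q′₁, the covariance C(C*ΔC)⁻¹C* of the
constrained Gaussian in the coordinates ω = Cω′ obeys |C′(y, y′)| ≤ c·e^{−δ|y−y′|} ("independent of j and Λ" = the
∃ precedes the ∀).  Chain: `kerReduction_printed` → `B6FromB4.reductions_uniform`.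
[cite: Balaban1984PropagatorsII, (2.110) p.242] -/
theorem site242_uniform (h5 : B4.Sect5ThmUniform d 1) (hL : 0 < L) {γ₀ c₀ δ₀ : ℝ} (hγ : 0 < γ₀)
    (hc : 0 < c₀) (hδ : 0 < δ₀) :
    ∃ c δ : ℝ, 0 < c ∧ 0 < δ ∧ ∀ (Λ : Finset (Fin d → ℤ)), BlockClosed L Λ →
      ∀ Δ : Matrix (B4.Idx Λ 1) (B4.Idx Λ 1) ℝ, Δ.IsSymm → KernelDecay Λ Δ c₀ δ₀ → LowerOnKer L Λ Δ γ₀ →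
        ∀ p q : B4.Idx Λ 1, |(kerReduction L Λ Δ).cov p q| ≤
          c * Real.exp (-(δ * dist (p.1 : Fin d → ℤ) (q.1 : Fin d → ℤ))) := by
  obtain ⟨c, δ, hc', hδ', H⟩ := B6FromB4.reductions_uniform (d := d) (N := 1) (N' := 1)
    (r := (L : ℝ) - 1) (mC := (L : ℝ) ^ d + 1) h5 hγ hc hδ (by positivity)
  exact ⟨c, δ, hc', hδ', fun Λ hΛ Δ hs hd hl p q =>
    H (kerReduction L Λ Δ) (kerReduction_printed hL hΛ hs hd hl) p q⟩

/-- The same for the regions Λ = ⋃_{y∈Λ′} B(y) of (2.89) (Λ′ any finite set of L-lattice points).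
[cite: Balaban1984PropagatorsII, (2.89) p.239 + (2.110) p.242] -/
theorem site242_uniform_region (h5 : B4.Sect5ThmUniform d 1) (hL : 0 < L) {γ₀ c₀ δ₀ : ℝ} (hγ : 0 < γ₀)
    (hc : 0 < c₀) (hδ : 0 < δ₀) :
    ∃ c δ : ℝ, 0 < c ∧ 0 < δ ∧ ∀ (Λ' : Finset (Fin d → ℤ))
      (Δ : Matrix (B4.Idx (region L Λ') 1) (B4.Idx (region L Λ') 1) ℝ),
        Δ.IsSymm → KernelDecay (region L Λ') Δ c₀ δ₀ → LowerOnKer L (region L Λ') Δ γ₀ →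
        ∀ p q : B4.Idx (region L Λ') 1, |(kerReduction L (region L Λ') Δ).cov p q| ≤
          c * Real.exp (-(δ * dist (p.1 : Fin d → ℤ) (q.1 : Fin d → ℤ))) := by
  obtain ⟨c, δ, hc', hδ', H⟩ := site242_uniform (L := L) h5 hL hγ hc hδ
  exact ⟨c, δ, hc', hδ', fun Λ' Δ hs hd hl => H _ (blockClosed_region hL Λ') Δ hs hd hl⟩

end Site242

end

end Literature.MathematicalPhysics.QuantumFieldTheory.Balaban1983to89.B6Elimination
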